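import Summits.NavierStokesRegularity.NavierStokesRegularity.Theses.AxisymmetricExtremality
import Summits.NavierStokesRegularity.NavierStokesRegularity.Theorems.AxisymmetricExtremalityAxisymmetricKatoGlobalNoSwirlStratum
import Summits.NavierStokesRegularity.NavierStokesRegularity.Theorems.AxisymmetricExtremalityClayDatumCritical
import Summits.NavierStokesRegularity.NavierStokesRegularity.Theorems.CertifiedBlowupCertifiedBlowupAxisymBlowupKatoLifespan
import Summits.NavierStokesRegularity.NavierStokesRegularity.Theorems.AxisymmetricExtremalityAxisymmetricKatoGlobalReduction
import Summits.NavierStokesRegularity.NavierStokesRegularity.Theorems.AxisymmetricExtremalityAxisymmetricKatoGlobalStubSereginLogSwirlOrigin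
import Summits.NavierStokesRegularity.NavierStokesRegularity.Theorems.AxisymmetricSwirlRegularity
import HarnessLib

/-!
# Strategist s20-g17 (family `-s`, independent second census) — typed companions of
# `STRATEGY-CENSUS-s20-g17.md` for the crux `AxisymmetricExtremality.AxisymmetricKatoGlobal`
# (stmt-NavierStokesRegularity-15453)

Every declaration here is sorry-free.  Nothing in this file proves the crux or the summit; it
records, as kernel-checked implications between NAMED statements, the census attempts:

1. summit-down: the weakest statement the route's `closes` tolerates in place of the crux
   (`NoAxisymMinimalBlowupDatum`), its swirl-free strengthening, and the re-glue;
2. decomposition: the Clay-class piece `ClayClassAxisymKatoGlobal` (= the conjecture leaf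
   `AxisymmetricSwirlRegularity` through Kato's lifespan) and the class-transfer piece, with the
   (trivial-seam) assembly proved and the piece ⇐ crux direction proved;
3. strengthen: the absolute-small-swirl rung `SmallSwirlKatoGlobal ε` as a consequence of the crux;
4. in-skeleton cut: the registered stub `stub_swirlAxisModulus` ALONE implies the crux, by landed
   theorems (capstone p150628 + the discharged Seregin-2022 fact);
5. negation: `¬ crux` unfolded, and why a Clay-class witness is summit-closing (¬(A)).
-/

noncomputable section

open Set MeasureTheory Function Filter Topology
open scoped ENNReal NNReal ContDiff
open Literature.Analysis.FluidPDE Literature.Analysis.FunctionSpaces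
open Summit.NavierStokesRegularity.NavierStokesRegularity.Theses.AxisymmetricExtremality

-- `<Problem> = <Summit>` duplicates a namespace component by design.
set_option linter.dupNamespace false

namespace Summit.NavierStokesRegularity.NavierStokesRegularity.Cruxes.AxisymmetricKatoGlobal.StrategistS20g17

local notation "ℝ³" => EuclideanSpace ℝ (Fin 3)
local notation "ℂ³" => EuclideanSpace ℂ (Fin 3)

/-! ## 1. Summit-down: the weakest intermediate the deciding theorem tolerates -/

/-- **W0** — no axisymmetric Rusin–Šverák minimal blow-up datum (for any `ν > 0`).  This is the
ONLY instance of the crux that `closes` consumes. -/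
def NoAxisymMinimalBlowupDatum : Prop :=
  ∀ ν : ℝ, 0 < ν → ∀ (u₀ : ℝ³ → ℝ³) (g : HomSobolev ℝ³ ℂ³ (1 / 2 : ℝ)),
    IsMinimalBlowupDatum ν u₀ g → IsAxisymmetric u₀ → False

/-- **W0′** — every axisymmetric minimal blow-up datum is swirl-free (then W0 follows from the
landed no-swirl stratum). -/
def AxisymMinimalBlowupDatumSwirlFree : Prop :=
  ∀ ν : ℝ, 0 < ν → ∀ (u₀ : ℝ³ → ℝ³) (g : HomSobolev ℝ³ ℂ³ (1 / 2 : ℝ)),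
    IsMinimalBlowupDatum ν u₀ g → IsAxisymmetric u₀ → HasNoSwirl u₀

/-- crux ⇒ W0 (one line: minimal data have no global Kato solution). -/
theorem noAxisymMinimal_of_crux (h : AxisymmetricKatoGlobal) : NoAxisymMinimalBlowupDatum := by
  intro ν hν u₀ g hmin hax
  obtain ⟨hL3, hrep, hdiv, -, hnot⟩ := hmin
  exact hnot (h ν hν u₀ g hL3 hrep hdiv (fun θ x => hax θ x))

/-- W0′ ⇒ W0, by the landed (unconditional) no-swirl stratum
`NoSwirlStratum.hasGlobalKatoSolution_of_isAxisymmetric_hasNoSwirl_viscosity`. -/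
theorem noAxisymMinimal_of_swirlFree (h : AxisymMinimalBlowupDatumSwirlFree) :
    NoAxisymMinimalBlowupDatum := by
  intro ν hν u₀ g hmin hax
  have hsw : HasNoSwirl u₀ := h ν hν u₀ g hmin hax
  obtain ⟨hL3, -, hdiv, -, hnot⟩ := hmin
  exact hnot (Theorems.AxisymmetricKatoGlobal.NoSwirlStratum.hasGlobalKatoSolution_of_isAxisymmetric_hasNoSwirl_viscosity
    hν hL3 hdiv hax hsw)

/-- **Re-glue**: the route's deciding theorem with W0 in place of the crux (same proof as
`Theses.AxisymmetricExtremality.closes`).  So W0 is the weakest statement short of the crux that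
the route can use — and it is the census's first target. -/
theorem closes_of_noAxisymMinimal (h₂ : MinimalDatumPFold) (h₄ : PFoldToAxisymmetric)
    (h₀ : NoAxisymMinimalBlowupDatum) : NavierStokesRegularity := by
  show Literature.NS.NavierStokesExistenceSmoothR3
  intro ν hν u₀ hsm hdiv hdec
  by_contra hno
  obtain ⟨u₁, g, hmin, hax⟩ := h₄ ν hν (h₂ ν hν ⟨u₀, hsm, hdiv, hdec, hno⟩)
  exact h₀ ν hν u₁ g hmin (fun θ x => hax θ x)

/-! ## 2. Decomposition: Clay-class piece ∧ class transfer -/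

/-- **AX_S** — the crux on Clay-class axisymmetric data (smooth, divergence-free, rapidly
decaying): a global Kato solution for every `ν > 0`. -/
def ClayClassAxisymKatoGlobal : Prop :=
  ∀ ν : ℝ, 0 < ν → ∀ u₀ : ℝ³ → ℝ³, ContDiff ℝ (⊤ : ℕ∞) u₀ → NSWave0.IsDivFree u₀ →
    HasRapidSpatialDecay u₀ → IsAxisymmetric u₀ → HasGlobalKatoSolution ν u₀

/-- **CT** — class transfer: regularity for Clay-class axisymmetric data implies it for every
`L³` datum represented in `Ḣ^{1/2}` (the crux's class). -/
def ClassTransfer : Prop := ClayClassAxisymKatoGlobal → AxisymmetricKatoGlobal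

/-- The assembly of the split (trivial seam, modus ponens). -/
theorem crux_of_split (h₁ : ClayClassAxisymKatoGlobal) (h₂ : ClassTransfer) :
    AxisymmetricKatoGlobal := h₂ h₁

/-- crux ⇒ AX_S (a Clay datum is a critical datum: landed `ClayDatumCritical`). -/
theorem clayClass_of_crux (h : AxisymmetricKatoGlobal) : ClayClassAxisymKatoGlobal := by
  intro ν hν u₀ hsm hdiv hdec hax
  obtain ⟨hL3, hwdiv, g, hrep⟩ := Theorems.axisymmetricExtremality_clayDatumCritical_proof u₀ hsm hdiv hdec
  exact h ν hν u₀ g hL3 hrep hwdiv (fun θ x => hax θ x)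

/-- crux ⇒ CT (trivially: CT's conclusion is the crux). Recorded so that "both pieces are
consequences of the crux" is explicit: the split is `crux ↔ AX_S ∧ CT`. -/
theorem classTransfer_of_crux (h : AxisymmetricKatoGlobal) : ClassTransfer := fun _ => h

/-- AX_S is, through Kato's lifespan (landed `axisymmetricSwirlRegularity_iff_forall_katoMaximalTime_eq_top`,
`katoMaximalTime_eq_top_iff`, `kato_unique_holds`), exactly the conjecture leaf ns.S25
`AxisymmetricSwirlRegularity` (axisymmetric case of Clay (A)) — a NAMED OPEN PROBLEM. -/
theorem clayClass_iff_axisymmetricSwirlRegularity :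
    ClayClassAxisymKatoGlobal ↔ Summit.NavierStokesRegularity.NavierStokesRegularity.AxisymmetricSwirlRegularity := by
  have key : ClayClassAxisymKatoGlobal ↔ Literature.Analysis.FluidPDE.AxisymmetricSwirlRegularity := by
    rw [Theorems.CertifiedBlowupAxisymBlowup.CompactAmplification.axisymmetricSwirlRegularity_iff_forall_katoMaximalTime_eq_top]
    constructor
    · intro h ν hν u₀ hsm hdiv hdec hax
      exact (h ν hν u₀ hsm (fun x => hdiv x) hdec hax).katoMaximalTime_eq_top
    · intro h ν hν u₀ hsm hdiv hdec hax
      exact hasGlobalKatoSolution_of_katoMaximalTime_eq_top kato_unique_holds hν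
        (h ν hν u₀ hsm (fun x => hdiv x) hdec hax)
  exact key

/-! ## 3. Strengthen / weaken: the absolute small-swirl rung -/

/-- **S_ε** — absolute small swirl: axisymmetric critical data with `|Γ₀| ≤ ε ν` everywhere have a
global Kato solution.  A consequence of the crux for every `ε`; for a FIXED small `ε` it is a
strictly weaker-looking statement which is NOT in print (all printed small-swirl theorems are
relative: Lei–Zhang 2017 Thm 1.4, Liu–Zhang 2018 Thm 1.2, Lemarié-Rieusset Thm 10.6). -/
def SmallSwirlKatoGlobal (ε : ℝ) : Prop :=
  ∀ ν : ℝ, 0 < ν → ∀ (u₀ : ℝ³ → ℝ³) (g : HomSobolev ℝ³ ℂ³ (1 / 2 : ℝ)),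
    MemLp u₀ 3 volume → g.Represents (Literature.Analysis.FunctionSpaces.EuclideanSpace.complexify ∘ u₀) →
    IsWeaklyDivFree u₀ → IsAxisymmetric u₀ → (∀ x, |swirl u₀ x| ≤ ε * ν) →
    HasGlobalKatoSolution ν u₀

/-- crux ⇒ S_ε for every ε (the swirl hypothesis is simply dropped). -/
theorem smallSwirl_of_crux (h : AxisymmetricKatoGlobal) (ε : ℝ) : SmallSwirlKatoGlobal ε :=
  fun ν hν u₀ g hL3 hrep hdiv hax _ => h ν hν u₀ g hL3 hrep hdiv (fun θ x => hax θ x)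

/-! ## 4. The in-skeleton cut: stub 3 alone implies the crux (landed) -/

/-- **crux ⇐ `stub_swirlAxisModulus`** by landed theorems only: the capstone
`Registered.AxisymmetricKatoGlobal_of_logSwirlFacts` (p150628) and the discharged Literature fact
`seregin2022_logSwirl_regularAtOrigin_holds`.  Hence the crux's entire open content is the
a-priori `log⁻³` axis modulus of `Γ = r u_θ` up to the Kato lifespan. -/
theorem crux_of_stubSwirlAxisModulus
    (h3 : ∀ ν : ℝ, 0 < ν → ∀ T : ℝ, 0 < T → ∀ (u₀ : ℝ³ → ℝ³)
      (g : HomSobolev ℝ³ (EuclideanSpace ℂ (Fin 3)) (1 / 2 : ℝ)) (u : ℝ → ℝ³ → ℝ³),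
      g.Represents (Literature.Analysis.FunctionSpaces.EuclideanSpace.complexify ∘ u₀) →
      IsKatoSolutionOn T ν u₀ u → ContDiffOn ℝ (⊤ : ℕ∞) (uncurry u) (Ioo 0 T ×ˢ univ) →
      (∀ t ∈ Ioo 0 T, IsAxisymmetric (u t)) →
      ∀ t₀ ∈ Ioo 0 T, ∃ C δ₀ : ℝ, 0 < δ₀ ∧ δ₀ < 1 ∧
        ∀ t ∈ Ico t₀ T, ∀ x : ℝ³, cylRadius x ≤ δ₀ →
          |swirl (u t) x| ≤ C / |Real.log (cylRadius x)| ^ 3) :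
    AxisymmetricKatoGlobal :=
  Theorems.AxisymmetricKatoGlobal.Registered.AxisymmetricKatoGlobal_of_logSwirlFacts
    Theorems.AxisymmetricKatoGlobal.EulerScaling.seregin2022_logSwirl_regularAtOrigin_holds h3

/-! ## 5. Negation -/

/-- `¬ crux` unfolded: an axisymmetric critical datum (L³, represented in `Ḣ^{1/2}`, weakly
divergence-free) WITHOUT a global Kato solution, at some `ν > 0`. -/
def AxisymCriticalBlowupDatumExists : Prop :=
  ∃ ν : ℝ, 0 < ν ∧ ∃ (u₀ : ℝ³ → ℝ³) (g : HomSobolev ℝ³ ℂ³ (1 / 2 : ℝ)),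
    MemLp u₀ 3 volume ∧ g.Represents (Literature.Analysis.FunctionSpaces.EuclideanSpace.complexify ∘ u₀) ∧
    IsWeaklyDivFree u₀ ∧ IsAxisymmetric u₀ ∧ ¬ HasGlobalKatoSolution ν u₀

theorem not_crux_iff : ¬ AxisymmetricKatoGlobal ↔ AxisymCriticalBlowupDatumExists := by
  constructor
  · intro h
    by_contra hne
    apply h
    intro ν hν u₀ g hL3 hrep hdiv hax
    by_contra hng
    exact hne ⟨ν, hν, u₀, g, hL3, hrep, hdiv, fun θ x => hax θ x, hng⟩
  · rintro ⟨ν, hν, u₀, g, hL3, hrep, hdiv, hax, hng⟩ h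
    exact hng (h ν hν u₀ g hL3 hrep hdiv (fun θ x => hax θ x))

/-- A negation witness INSIDE the Clay class is summit-closing: a smooth, divergence-free,
rapidly decaying datum without a global Kato solution refutes Clay (A) (landed
`navierStokesRegularity_iff_forall_katoMaximalTime_eq_top` + `hasGlobalKatoSolution_of_katoMaximalTime_eq_top`),
hence closes the board through (C).  Only an infinite-energy (`L³ \ L²`-type) axisymmetric
blow-up datum would refute the crux while leaving (A) untouched. -/
theorem not_summit_of_clayClass_blowupDatum {ν : ℝ} (hν : 0 < ν) {u₀ : ℝ³ → ℝ³}
    (hsm : ContDiff ℝ (⊤ : ℕ∞) u₀) (hdiv : NSWave0.IsDivFree u₀) (hdec : HasRapidSpatialDecay u₀)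
    (hng : ¬ HasGlobalKatoSolution ν u₀) : ¬ NavierStokesRegularity := by
  intro hS
  have h := (Theorems.CertifiedBlowupAxisymBlowup.CompactAmplification.navierStokesRegularity_iff_forall_katoMaximalTime_eq_top).1
    hS ν hν u₀ hsm (fun x => hdiv x) hdec
  exact hng (hasGlobalKatoSolution_of_katoMaximalTime_eq_top kato_unique_holds hν h)

end Summit.NavierStokesRegularity.NavierStokesRegularity.Cruxes.AxisymmetricKatoGlobal.StrategistS20g17

end
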